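import Mathlib
import Summits.NavierStokesRegularity.NavierStokesRegularity.Theorems.EulerZoomLiouvillePowerGaugeEulerLiouvilleHoopCircleInequality

/-!
# LEL-1: THE θ̂-COLUMN CONTROLS EVERY NON-SINUOUS MODE ON A CIRCLE (LEAD 19832 g15; nsreg-p2 ROUND-50 t53-LEL, first of three files)

Helper for crux `EulerZoomLiouville.PowerGaugeEulerLiouville` (stmt-NavierStokesRegularity-19832), LEAD ns-typeII-p2 g15,
`--supports stmt-NavierStokesRegularity-19832 --as helper`.

nsreg-p2 g40's ROUND-50 «THE WALL COMES FOR FREE» (§1, `r50/Sketch50.lean` 6c31f8f6e879902e) needs the LATERAL term `2π∫⟨V_r²⟩_θ(σ,T₀)dσ`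
of the axis law to be paid by the tube's own energy.  On one circle (`a = V_r`, `b = V_θ` as functions of the angle, `a′ − b = t⟪DVê_θ, ê_r⟫`,
`b′ + a = t⟪DVê_θ, ê_θ⟫`, the θ̂-COLUMN of the velocity gradient) the modal statement behind it is the 1-D inequality of this file, with
CONSTANT 1 and for BOTH components:

* `lateral_modes_le` — for `a, b : ℝ → ℝ` with continuous derivatives and `2π`-periodic values,
  `∫₀^{2π} (a − P₁a)² + ∫₀^{2π} (b − P₁b)² ≤ ∫₀^{2π} [(a′ − b)² + (b′ + a)²]`,
  `P₁g = π⁻¹(∫g cos) cos + π⁻¹(∫g sin) sin` (written out): every mode `m ≠ ±1` of `V_r` AND `V_θ` (the mean `m = 0` included) is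
  controlled by the θ̂-column alone; the sinuous modes `m = ±1` are the ones the radial law of `…HoopRadialModes` handles
  (`firstMode_energy_radial`: their `t = T₀` value is exactly the term DROPPED in `hoop_slice_le`).

NON-MODAL PROOF (no Parseval beyond ns-ezl-w2 g5's `wirtinger_four`): `∫[(a′−b)² + (b′+a)²] = ∫(a′² + b′² + a² + b²) + 4∫ab′` (one
integration by parts); writing `a = a₁ + p`, `b = b₁ + q` (first modes + rests) every cross integral between a first-mode function and a
rest vanishes, the first-mode block is `2π⁻¹[(Ca + Sb)² + (Sa − Cb)²] ≥ 0`, and the rest block is `∫p′² + ∫q′² + 4∫pq′ + ∫p² + ∫q²`, where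

* `cross_modes_nonneg` — `0 ≤ ∫p′² + ∫q′² + 4∫pq′` for `p` with no first modes and ANY periodic `q`: `∫pq′ = ∫(p − p̄)q′` (`∫q′ = 0`),
  Cauchy–Schwarz and `wirtinger_four` (`4∫(p − p̄)² ≤ ∫p′²`) give `(4∫pq′)² ≤ 4∫p′²∫q′² ≤ (∫p′² + ∫q′²)²`.

(Per mode this is `(|m| − 1)²(|a_m|² + |b_m|²) ≤ |ima_m − b_m|² + |imb_m + a_m|²`; the non-modal route loses nothing at `|m| = 0, 2`.)

HONEST FRAMING: a 1-D inequality; it proves nothing about the crux E (19832 OPEN), the lateral hoop inequality as a whole, or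
Navier–Stokes regularity. [folklore; nsreg-p2 ROUND-50 §1; ns-idea-11 HOOP-NOTE §10(a)]
-/

noncomputable section

open Set Filter Topology Metric Function MeasureTheory Real
open scoped Interval

set_option linter.dupNamespace false

namespace Summit.NavierStokesRegularity.NavierStokesRegularity.Theorems.PowerGaugeEulerLiouville.HoopCore

/-- **THE CROSS TERM OF THE RESTS IS DOMINATED**: for `p, q : ℝ → ℝ` with continuous derivatives, `2π`-periodic values, and `p`
orthogonal to the first modes (`∫₀^{2π} p cos = ∫₀^{2π} p sin = 0`): `0 ≤ ∫₀^{2π} p′² + ∫₀^{2π} q′² + 4∫₀^{2π} p q′`.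
(`∫pq′ = ∫(p − p̄)q′` since `∫q′ = 0`; Cauchy–Schwarz; `wirtinger_four`.) [folklore] -/
theorem cross_modes_nonneg {p p' q q' : ℝ → ℝ} (hp : ∀ x, HasDerivAt p (p' x) x) (hp' : Continuous p')
    (hpper : p (2 * π) = p 0) (hq : ∀ x, HasDerivAt q (q' x) x) (hq' : Continuous q') (hqper : q (2 * π) = q 0)
    (hcos : ∫ x in (0 : ℝ)..2 * π, p x * Real.cos x = 0) (hsin : ∫ x in (0 : ℝ)..2 * π, p x * Real.sin x = 0) :
    0 ≤ (∫ x in (0 : ℝ)..2 * π, p' x ^ 2) + (∫ x in (0 : ℝ)..2 * π, q' x ^ 2) +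
      4 * ∫ x in (0 : ℝ)..2 * π, p x * q' x := by
  have hpc : Continuous p := continuous_iff_continuousAt.2 fun x => (hp x).continuousAt
  have h2π : (0 : ℝ) ≤ 2 * π := by positivity
  set m : ℝ := (2 * π)⁻¹ * ∫ y in (0 : ℝ)..2 * π, p y with hm
  -- Wirtinger with constant 4 for `p`
  have hW := wirtinger_four hp hp' hpper hcos hsin
  rw [← hm] at hW
  -- `∫ q′ = 0`
  have hq0 : ∫ x in (0 : ℝ)..2 * π, q' x = 0 := by
    rw [intervalIntegral.integral_eq_sub_of_hasDerivAt (fun x _ => hq x) (hq'.intervalIntegrable _ _), hqper, sub_self]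
  -- `∫ p q′ = ∫ (p − m) q′`
  have hI : ∫ x in (0 : ℝ)..2 * π, p x * q' x = ∫ x in (0 : ℝ)..2 * π, (p x - m) * q' x := by
    have i1 : IntervalIntegrable (fun x => p x * q' x) volume 0 (2 * π) := (hpc.mul hq').intervalIntegrable _ _
    have i2 : IntervalIntegrable (fun x => m * q' x) volume 0 (2 * π) := (hq'.const_mul m).intervalIntegrable _ _
    rw [show (fun x => (p x - m) * q' x) = fun x => p x * q' x - m * q' x from funext fun x => by ring,
      intervalIntegral.integral_sub i1 i2, intervalIntegral.integral_const_mul, hq0, mul_zero, sub_zero]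
  -- Cauchy–Schwarz
  have hCS := Condenser.sq_integral_mul_le_of_intervalIntegrable (f := fun x => p x - m) (g := q') h2π
    (((hpc.sub continuous_const).pow 2).intervalIntegrable _ _) ((hq'.pow 2).intervalIntegrable _ _)
    (((hpc.sub continuous_const).mul hq').intervalIntegrable _ _)
  rw [← hI] at hCS
  set I := ∫ x in (0 : ℝ)..2 * π, p x * q' x with hIdef
  set A := ∫ x in (0 : ℝ)..2 * π, (p x - m) ^ 2 with hA
  set P := ∫ x in (0 : ℝ)..2 * π, p' x ^ 2 with hP
  set B := ∫ x in (0 : ℝ)..2 * π, q' x ^ 2 with hB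
  have hA0 : 0 ≤ A := intervalIntegral.integral_nonneg h2π fun x _ => sq_nonneg _
  have hB0 : 0 ≤ B := intervalIntegral.integral_nonneg h2π fun x _ => sq_nonneg _
  have hP0 : 0 ≤ P := intervalIntegral.integral_nonneg h2π fun x _ => sq_nonneg _
  -- `4 I² ≤ P B`
  have h4 : 4 * I ^ 2 ≤ P * B := by
    calc 4 * I ^ 2 ≤ 4 * (A * B) := by nlinarith [hCS]
      _ = (4 * A) * B := by ring
      _ ≤ P * B := mul_le_mul_of_nonneg_right hW hB0
  nlinarith [sq_nonneg (P - B), sq_nonneg (P + B + 4 * I), h4, mul_nonneg hP0 hB0, sq_nonneg I]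

/-- **LEL-1 — THE θ̂-COLUMN CONTROLS EVERY NON-SINUOUS MODE** (constant 1, both components).  For `a, b : ℝ → ℝ` with continuous
derivatives `a′, b′` and `a(2π) = a(0)`, `b(2π) = b(0)`:
`∫₀^{2π} (a − P₁a)² + ∫₀^{2π} (b − P₁b)² ≤ ∫₀^{2π} [(a′ − b)² + (b′ + a)²]`, `P₁g = π⁻¹(∫g cos) cos + π⁻¹(∫g sin) sin`.
In the lateral hoop inequality `a = V_r`, `b = V_θ` on a circle of radius `t` about the axis and the right side is `t²` times the
θ̂-column `⟪DVê_θ, ê_r⟫² + ⟪DVê_θ, ê_θ⟫²` integrated over the circle. [folklore; nsreg-p2 ROUND-50 §1] -/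
theorem lateral_modes_le {a a' b b' : ℝ → ℝ} (ha : ∀ x, HasDerivAt a (a' x) x) (ha' : Continuous a')
    (haper : a (2 * π) = a 0) (hb : ∀ x, HasDerivAt b (b' x) x) (hb' : Continuous b') (hbper : b (2 * π) = b 0) :
    (∫ x in (0 : ℝ)..2 * π,
        (a x - (π⁻¹ * (∫ y in (0 : ℝ)..2 * π, a y * Real.cos y) * Real.cos x +
          π⁻¹ * (∫ y in (0 : ℝ)..2 * π, a y * Real.sin y) * Real.sin x)) ^ 2) +
      (∫ x in (0 : ℝ)..2 * π,
        (b x - (π⁻¹ * (∫ y in (0 : ℝ)..2 * π, b y * Real.cos y) * Real.cos x +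
          π⁻¹ * (∫ y in (0 : ℝ)..2 * π, b y * Real.sin y) * Real.sin x)) ^ 2) ≤
      ∫ x in (0 : ℝ)..2 * π, ((a' x - b x) ^ 2 + (b' x + a x) ^ 2) := by
  have hac : Continuous a := continuous_iff_continuousAt.2 fun x => (ha x).continuousAt
  have hbc : Continuous b := continuous_iff_continuousAt.2 fun x => (hb x).continuousAt
  have hπ : (π : ℝ) ≠ 0 := Real.pi_ne_zero
  have hπ0 : 0 < π := Real.pi_pos
  -- the four first-mode coefficients
  set Ca := ∫ y in (0 : ℝ)..2 * π, a y * Real.cos y with hCa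
  set Sa := ∫ y in (0 : ℝ)..2 * π, a y * Real.sin y with hSa
  set Cb := ∫ y in (0 : ℝ)..2 * π, b y * Real.cos y with hCb
  set Sb := ∫ y in (0 : ℝ)..2 * π, b y * Real.sin y with hSb
  obtain ⟨hCa', hSa'⟩ := firstMode_coeffs_deriv ha ha' haper
  obtain ⟨hCb', hSb'⟩ := firstMode_coeffs_deriv hb hb' hbper
  -- the first-mode parts and the remainders
  set a₁ : ℝ → ℝ := fun x => π⁻¹ * Ca * Real.cos x + π⁻¹ * Sa * Real.sin x with ha₁
  set a₁d : ℝ → ℝ := fun x => π⁻¹ * Sa * Real.cos x + π⁻¹ * (-Ca) * Real.sin x with ha₁d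
  set b₁ : ℝ → ℝ := fun x => π⁻¹ * Cb * Real.cos x + π⁻¹ * Sb * Real.sin x with hb₁
  set b₁d : ℝ → ℝ := fun x => π⁻¹ * Sb * Real.cos x + π⁻¹ * (-Cb) * Real.sin x with hb₁d
  have hfm_deriv : ∀ C S : ℝ, ∀ x, HasDerivAt (fun x => π⁻¹ * C * Real.cos x + π⁻¹ * S * Real.sin x)
      (π⁻¹ * S * Real.cos x + π⁻¹ * (-C) * Real.sin x) x := by
    intro C S x
    have h := ((Real.hasDerivAt_cos x).const_mul (π⁻¹ * C)).add ((Real.hasDerivAt_sin x).const_mul (π⁻¹ * S))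
    refine h.congr_deriv ?_
    ring
  have ha₁D : ∀ x, HasDerivAt a₁ (a₁d x) x := fun x => hfm_deriv Ca Sa x
  have hb₁D : ∀ x, HasDerivAt b₁ (b₁d x) x := fun x => hfm_deriv Cb Sb x
  set p : ℝ → ℝ := fun x => a x - a₁ x with hp
  set p' : ℝ → ℝ := fun x => a' x - a₁d x with hp'
  set q : ℝ → ℝ := fun x => b x - b₁ x with hq
  set q' : ℝ → ℝ := fun x => b' x - b₁d x with hq'
  have hpD : ∀ x, HasDerivAt p (p' x) x := fun x => (ha x).sub (ha₁D x)
  have hqD : ∀ x, HasDerivAt q (q' x) x := fun x => (hb x).sub (hb₁D x)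
  have hp'c : Continuous p' := by rw [hp', ha₁d]; fun_prop
  have hq'c : Continuous q' := by rw [hq', hb₁d]; fun_prop
  have hpper : p (2 * π) = p 0 := by simp [hp, ha₁, haper]
  have hqper : q (2 * π) = q 0 := by simp [hq, hb₁, hbper]
  -- `p` has no first modes
  have hCp : ∫ x in (0 : ℝ)..2 * π, p x * Real.cos x = 0 := by
    have h := integral_firstMode_mul_sub_proj hac 1 0
    rw [← hCa, ← hSa] at h
    calc ∫ x in (0 : ℝ)..2 * π, p x * Real.cos x
        = ∫ x in (0 : ℝ)..2 * π, (1 * Real.cos x + 0 * Real.sin x) *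
            (a x - (π⁻¹ * Ca * Real.cos x + π⁻¹ * Sa * Real.sin x)) :=
          intervalIntegral.integral_congr fun x _ => by rw [hp, ha₁]; ring
      _ = 0 := h
  have hSp : ∫ x in (0 : ℝ)..2 * π, p x * Real.sin x = 0 := by
    have h := integral_firstMode_mul_sub_proj hac 0 1
    rw [← hCa, ← hSa] at h
    calc ∫ x in (0 : ℝ)..2 * π, p x * Real.sin x
        = ∫ x in (0 : ℝ)..2 * π, (0 * Real.cos x + 1 * Real.sin x) *
            (a x - (π⁻¹ * Ca * Real.cos x + π⁻¹ * Sa * Real.sin x)) :=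
          intervalIntegral.integral_congr fun x _ => by rw [hp, ha₁]; ring
      _ = 0 := h
  -- the cross term of the rests
  have hF := cross_modes_nonneg hpD hp'c hpper hqD hq'c hqper hCp hSp
  -- first-mode evaluations
  have e1 : ∫ x in (0 : ℝ)..2 * π, a₁d x * a' x = π⁻¹ * Sa * Sa + π⁻¹ * (-Ca) * (-Ca) := by
    rw [ha₁d, integral_firstMode_mul ha', hCa', hSa']
  have e2 : ∫ x in (0 : ℝ)..2 * π, a₁d x ^ 2 = π * ((π⁻¹ * Sa) ^ 2 + (π⁻¹ * (-Ca)) ^ 2) := by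
    rw [ha₁d, integral_firstMode_sq]
  have e3 : ∫ x in (0 : ℝ)..2 * π, b₁d x * b' x = π⁻¹ * Sb * Sb + π⁻¹ * (-Cb) * (-Cb) := by
    rw [hb₁d, integral_firstMode_mul hb', hCb', hSb']
  have e4 : ∫ x in (0 : ℝ)..2 * π, b₁d x ^ 2 = π * ((π⁻¹ * Sb) ^ 2 + (π⁻¹ * (-Cb)) ^ 2) := by
    rw [hb₁d, integral_firstMode_sq]
  have e5 : ∫ x in (0 : ℝ)..2 * π, b₁ x * b x = π⁻¹ * Cb * Cb + π⁻¹ * Sb * Sb := by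
    rw [hb₁, integral_firstMode_mul hbc]
  have e6 : ∫ x in (0 : ℝ)..2 * π, b₁ x ^ 2 = π * ((π⁻¹ * Cb) ^ 2 + (π⁻¹ * Sb) ^ 2) := by
    rw [hb₁, integral_firstMode_sq]
  have e7 : ∫ x in (0 : ℝ)..2 * π, b₁d x * a x = π⁻¹ * Sb * Ca + π⁻¹ * (-Cb) * Sa := by
    rw [hb₁d, integral_firstMode_mul hac]
  have e8 : ∫ x in (0 : ℝ)..2 * π, a₁ x * b' x = π⁻¹ * Ca * Sb + π⁻¹ * Sa * (-Cb) := by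
    rw [ha₁, integral_firstMode_mul hb', hCb', hSb']
  have e9 : ∫ x in (0 : ℝ)..2 * π, a₁ x * b₁d x = π * (π⁻¹ * Ca * (π⁻¹ * Sb) + π⁻¹ * Sa * (π⁻¹ * (-Cb))) := by
    rw [ha₁, hb₁d, integral_firstMode_mul_firstMode]
  have e10 : ∫ x in (0 : ℝ)..2 * π, a₁ x * a x = π⁻¹ * Ca * Ca + π⁻¹ * Sa * Sa := by
    rw [ha₁, integral_firstMode_mul hac]
  have e11 : ∫ x in (0 : ℝ)..2 * π, a₁ x ^ 2 = π * ((π⁻¹ * Ca) ^ 2 + (π⁻¹ * Sa) ^ 2) := by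
    rw [ha₁, integral_firstMode_sq]
  have hc_a₁ : Continuous a₁ := by rw [ha₁]; fun_prop
  have hc_a₁d : Continuous a₁d := by rw [ha₁d]; fun_prop
  have hc_b₁ : Continuous b₁ := by rw [hb₁]; fun_prop
  have hc_b₁d : Continuous b₁d := by rw [hb₁d]; fun_prop
  -- expansions of the three integrals of `cross_modes_nonneg`
  have x1 : ∫ x in (0 : ℝ)..2 * π, p' x ^ 2 =
      (∫ x in (0 : ℝ)..2 * π, a' x ^ 2) - 2 * (∫ x in (0 : ℝ)..2 * π, a₁d x * a' x) + ∫ x in (0 : ℝ)..2 * π, a₁d x ^ 2 := by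
    have e : (fun x => p' x ^ 2) = fun x => a' x ^ 2 - 2 * (a₁d x * a' x) + a₁d x ^ 2 := funext fun x => by
      simp only [hp']; ring
    rw [e, intervalIntegral.integral_add, intervalIntegral.integral_sub, intervalIntegral.integral_const_mul]
    · exact (ha'.pow 2).intervalIntegrable _ _
    · exact ((hc_a₁d.mul ha').const_mul 2).intervalIntegrable _ _
    · exact ((ha'.pow 2).sub ((hc_a₁d.mul ha').const_mul 2)).intervalIntegrable _ _
    · exact (hc_a₁d.pow 2).intervalIntegrable _ _
  have x2 : ∫ x in (0 : ℝ)..2 * π, q' x ^ 2 =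
      (∫ x in (0 : ℝ)..2 * π, b' x ^ 2) - 2 * (∫ x in (0 : ℝ)..2 * π, b₁d x * b' x) + ∫ x in (0 : ℝ)..2 * π, b₁d x ^ 2 := by
    have e : (fun x => q' x ^ 2) = fun x => b' x ^ 2 - 2 * (b₁d x * b' x) + b₁d x ^ 2 := funext fun x => by
      simp only [hq']; ring
    rw [e, intervalIntegral.integral_add, intervalIntegral.integral_sub, intervalIntegral.integral_const_mul]
    · exact (hb'.pow 2).intervalIntegrable _ _
    · exact ((hc_b₁d.mul hb').const_mul 2).intervalIntegrable _ _
    · exact ((hb'.pow 2).sub ((hc_b₁d.mul hb').const_mul 2)).intervalIntegrable _ _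
    · exact (hc_b₁d.pow 2).intervalIntegrable _ _
  have x4 : ∫ x in (0 : ℝ)..2 * π, p x * q' x =
      (∫ x in (0 : ℝ)..2 * π, a x * b' x) - (∫ x in (0 : ℝ)..2 * π, b₁d x * a x) -
        (∫ x in (0 : ℝ)..2 * π, a₁ x * b' x) + ∫ x in (0 : ℝ)..2 * π, a₁ x * b₁d x := by
    have e : (fun x => p x * q' x) = fun x => a x * b' x - b₁d x * a x - a₁ x * b' x + a₁ x * b₁d x :=
      funext fun x => by simp only [hp, hq']; ring
    rw [e, intervalIntegral.integral_add, intervalIntegral.integral_sub, intervalIntegral.integral_sub]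
    · exact (hac.mul hb').intervalIntegrable _ _
    · exact (hc_b₁d.mul hac).intervalIntegrable _ _
    · exact ((hac.mul hb').sub (hc_b₁d.mul hac)).intervalIntegrable _ _
    · exact (hc_a₁.mul hb').intervalIntegrable _ _
    · exact (((hac.mul hb').sub (hc_b₁d.mul hac)).sub (hc_a₁.mul hb')).intervalIntegrable _ _
    · exact (hc_a₁.mul hc_b₁d).intervalIntegrable _ _
  -- expansions of the two integrals of the left side (Pythagoras)
  have z1 : ∫ x in (0 : ℝ)..2 * π, (a x - (π⁻¹ * Ca * Real.cos x + π⁻¹ * Sa * Real.sin x)) ^ 2 =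
      (∫ x in (0 : ℝ)..2 * π, a x ^ 2) - 2 * (∫ x in (0 : ℝ)..2 * π, a₁ x * a x) + ∫ x in (0 : ℝ)..2 * π, a₁ x ^ 2 := by
    have e : (fun x => (a x - (π⁻¹ * Ca * Real.cos x + π⁻¹ * Sa * Real.sin x)) ^ 2) =
        fun x => a x ^ 2 - 2 * (a₁ x * a x) + a₁ x ^ 2 := funext fun x => by simp only [ha₁]; ring
    rw [e, intervalIntegral.integral_add, intervalIntegral.integral_sub, intervalIntegral.integral_const_mul]
    · exact (hac.pow 2).intervalIntegrable _ _
    · exact ((hc_a₁.mul hac).const_mul 2).intervalIntegrable _ _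
    · exact ((hac.pow 2).sub ((hc_a₁.mul hac).const_mul 2)).intervalIntegrable _ _
    · exact (hc_a₁.pow 2).intervalIntegrable _ _
  have z2 : ∫ x in (0 : ℝ)..2 * π, (b x - (π⁻¹ * Cb * Real.cos x + π⁻¹ * Sb * Real.sin x)) ^ 2 =
      (∫ x in (0 : ℝ)..2 * π, b x ^ 2) - 2 * (∫ x in (0 : ℝ)..2 * π, b₁ x * b x) + ∫ x in (0 : ℝ)..2 * π, b₁ x ^ 2 := by
    have e : (fun x => (b x - (π⁻¹ * Cb * Real.cos x + π⁻¹ * Sb * Real.sin x)) ^ 2) =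
        fun x => b x ^ 2 - 2 * (b₁ x * b x) + b₁ x ^ 2 := funext fun x => by simp only [hb₁]; ring
    rw [e, intervalIntegral.integral_add, intervalIntegral.integral_sub, intervalIntegral.integral_const_mul]
    · exact (hbc.pow 2).intervalIntegrable _ _
    · exact ((hc_b₁.mul hbc).const_mul 2).intervalIntegrable _ _
    · exact ((hbc.pow 2).sub ((hc_b₁.mul hbc).const_mul 2)).intervalIntegrable _ _
    · exact (hc_b₁.pow 2).intervalIntegrable _ _
  -- expansion of the right side
  have hIBP : ∫ x in (0 : ℝ)..2 * π, a' x * b x = -∫ x in (0 : ℝ)..2 * π, a x * b' x := by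
    have h := intervalIntegral.integral_mul_deriv_eq_deriv_mul (a := 0) (b := 2 * π) (u := a) (v := b)
      (u' := a') (v' := b') (fun x _ => ha x) (fun x _ => hb x) (ha'.intervalIntegrable _ _) (hb'.intervalIntegrable _ _)
    rw [haper, hbper, sub_self, zero_sub] at h
    rw [h, neg_neg]
  have y1 : ∫ x in (0 : ℝ)..2 * π, ((a' x - b x) ^ 2 + (b' x + a x) ^ 2) =
      (∫ x in (0 : ℝ)..2 * π, a' x ^ 2) + (∫ x in (0 : ℝ)..2 * π, b' x ^ 2) + (∫ x in (0 : ℝ)..2 * π, a x ^ 2) +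
        (∫ x in (0 : ℝ)..2 * π, b x ^ 2) - 2 * (∫ x in (0 : ℝ)..2 * π, a' x * b x) +
        2 * ∫ x in (0 : ℝ)..2 * π, a x * b' x := by
    have e : (fun x => (a' x - b x) ^ 2 + (b' x + a x) ^ 2) =
        fun x => a' x ^ 2 + b' x ^ 2 + a x ^ 2 + b x ^ 2 - 2 * (a' x * b x) + 2 * (a x * b' x) := funext fun x => by ring
    have i1 : IntervalIntegrable (fun x => a' x ^ 2) volume 0 (2 * π) := (ha'.pow 2).intervalIntegrable _ _
    have i2 : IntervalIntegrable (fun x => b' x ^ 2) volume 0 (2 * π) := (hb'.pow 2).intervalIntegrable _ _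
    have i3 : IntervalIntegrable (fun x => a x ^ 2) volume 0 (2 * π) := (hac.pow 2).intervalIntegrable _ _
    have i4 : IntervalIntegrable (fun x => b x ^ 2) volume 0 (2 * π) := (hbc.pow 2).intervalIntegrable _ _
    have i5 : IntervalIntegrable (fun x => 2 * (a' x * b x)) volume 0 (2 * π) :=
      ((ha'.mul hbc).const_mul 2).intervalIntegrable _ _
    have i6 : IntervalIntegrable (fun x => 2 * (a x * b' x)) volume 0 (2 * π) :=
      ((hac.mul hb').const_mul 2).intervalIntegrable _ _
    rw [e, intervalIntegral.integral_add ((((i1.add i2).add i3).add i4).sub i5) i6,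
      intervalIntegral.integral_sub (((i1.add i2).add i3).add i4) i5,
      intervalIntegral.integral_add ((i1.add i2).add i3) i4, intervalIntegral.integral_add (i1.add i2) i3,
      intervalIntegral.integral_add i1 i2, intervalIntegral.integral_const_mul, intervalIntegral.integral_const_mul]
  -- simplify the first-mode scalars
  have key : π * ((π⁻¹ * Sa) ^ 2 + (π⁻¹ * (-Ca)) ^ 2) = π⁻¹ * (Sa ^ 2 + Ca ^ 2) := by field_simp
  have key2 : π * ((π⁻¹ * Sb) ^ 2 + (π⁻¹ * (-Cb)) ^ 2) = π⁻¹ * (Sb ^ 2 + Cb ^ 2) := by field_simp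
  have key3 : π * ((π⁻¹ * Cb) ^ 2 + (π⁻¹ * Sb) ^ 2) = π⁻¹ * (Cb ^ 2 + Sb ^ 2) := by field_simp
  have key4 : π * (π⁻¹ * Ca * (π⁻¹ * Sb) + π⁻¹ * Sa * (π⁻¹ * (-Cb))) = π⁻¹ * (Ca * Sb - Sa * Cb) := by
    field_simp; ring
  have key5 : π * ((π⁻¹ * Ca) ^ 2 + (π⁻¹ * Sa) ^ 2) = π⁻¹ * (Ca ^ 2 + Sa ^ 2) := by field_simp
  rw [key] at e2
  rw [key2] at e4
  rw [key3] at e6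
  rw [key4] at e9
  rw [key5] at e11
  rw [x1, x2, x4, e1, e2, e3, e4, e7, e8, e9] at hF
  rw [z1, z2, y1, hIBP, e10, e11, e5, e6]
  -- nonnegative first-mode block and the final count
  set ip := π⁻¹ with hip
  have hip0 : 0 ≤ ip := inv_nonneg.2 hπ0.le
  have hsq : 0 ≤ ip * ((Ca + Sb) ^ 2 + (Sa - Cb) ^ 2) := by positivity
  linear_combination hF + 2 * hsq

end Summit.NavierStokesRegularity.NavierStokesRegularity.Theorems.PowerGaugeEulerLiouville.HoopCore

end
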